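import Mathlib
import Summits.AtomisticToContinuum.Crystallization.Theorems.FrustratedLawDichotomyPeriodicMuGSC
import Summits.AtomisticToContinuum.Crystallization.Theorems.FrustratedLawDichotomyGSCSurgeryCertificates

/-!
# FrustratedLawDichotomy · cruxes `PeriodicFrustratedLawGap` / `NoFrustratedPeriodicMinimiser` (stmt-AtomisticToContinuum-27624 / 26654) —
# THE CENSUS-READY TRUNCATED SURGERY TEST FOR PERIODIC CANDIDATES, UNCONDITIONAL
# (decomp-a2c, prover hand 2, structural share, generation 5)

What a census actually computes: a finite surgery on the point set of a periodic candidate `Q` (remove `xf`, insert `R`), its balance with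
every field TRUNCATED at radius `Rc`, and the explicit tail load `(n + k)·T(δ, Rc)`, `T(δ, Rc) = (δ⁻⁶/12 + 1/6)·1024/(δ³Rc³)`.
`eStar_lt_energyPerParticle_of_truncated_surgery_periodic'`: if `Δ_{≤Rc} + (n + k)·T(δ, Rc) < e(Q)·(k − n)` then `e⋆ < e(Q)` — with NO door
(item 27073), NO bound on `e⋆`, on `Q.points` itself (no motif view): the unconditional periodic μGSC theorem
`FrustratedLawDichotomyPeriodicMuGSC.isMuGSC_points_of_energyPerParticle_le` combined with the truncated certificate
`FrustratedLawDichotomyGSCSurgeryCertificates.not_isMuGSC_of_truncated_surgery`.  Also the exact (untruncated) form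
`eStar_lt_energyPerParticle_of_surgery_periodic'` for all `(n, k)`.  `[folklore]`.
-/

noncomputable section

namespace Summit.AtomisticToContinuum.Crystallization.Theorems.FrustratedLawDichotomyPeriodicTruncatedTest

open Literature.MathematicalPhysics.StatisticalMechanics
open Summit.AtomisticToContinuum.Crystallization.Theorems.ChargedEnergyGapNegative (E3 eStar eStar_le)
open Summit.AtomisticToContinuum.Crystallization.Theorems.FrustratedLawDichotomyPeriodicMuGSC (isMuGSC_points_of_energyPerParticle_le)
open Summit.AtomisticToContinuum.Crystallization.Theorems.FrustratedLawDichotomyGSCSurgeryCertificates (not_isMuGSC_of_truncated_surgery)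

/-- **EXACT SURGERY TEST on `Q.points`, all `(n, k)`, unconditional**: a finite surgery on a `δ`-separated periodic `Q` with balance
`Δ < e(Q)·(k − n)` certifies `e⋆ < e(Q)`. [folklore] -/
theorem eStar_lt_energyPerParticle_of_surgery_periodic' (Q : PeriodicConfiguration 3)
    {δ : ℝ} (hδ : 0 < δ) (hsep : ∀ p ∈ Q.points, ∀ q ∈ Q.points, p ≠ q → δ ≤ dist p q)
    {n : ℕ} {xf : Fin n → E3} (hxf : Function.Injective xf) (hX : Set.range xf ⊆ Q.points)
    {k : ℕ} {R : Fin k → E3} (hR : Function.Injective R) (hdisj : Disjoint (Set.range R) (Q.points \ Set.range xf))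
    (hΔ : (interactionEnergy lennardJones R + ∑ i, ∑' y : ↥(Q.points \ Set.range xf), lennardJones (dist (R i) y)) -
        (interactionEnergy lennardJones xf + ∑ i, ∑' y : ↥(Q.points \ Set.range xf), lennardJones (dist (xf i) y)) <
        Q.energyPerParticle lennardJones * ((k : ℝ) - n)) :
    (⨅ Q' : PeriodicConfiguration 3, Q'.energyPerParticle lennardJones) < Q.energyPerParticle lennardJones := by
  by_contra hle
  rw [not_lt] at hle
  have hG := isMuGSC_points_of_energyPerParticle_le Q hδ hsep hle
  have heq : Q.energyPerParticle lennardJones = ⨅ Q' : PeriodicConfiguration 3, Q'.energyPerParticle lennardJones :=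
    le_antisymm hle (eStar_le Q)
  have h := hG.le hxf hX hR hdisj
  rw [← heq] at h
  rw [mul_sub] at hΔ
  linarith

/-- **TRUNCATED SURGERY TEST on `Q.points`, unconditional (census form).**  `Q` `δ`-separated periodic; remove the `n` distinct atoms `xf`, insert
the `k` distinct atoms `R` off `Q ∖ xf`; `Rc ≥ δ`; `tf i` / `tR i` the atoms of `Q ∖ xf` within `Rc` of `xf i` / `R i`.  If
`[U(R) + Σ_i I_{≤Rc}(R i)] − [U(xf) + Σ_i I_{≤Rc}(xf i)] + (n + k)·T(δ, Rc) < e(Q)·(k − n)`, then `e⋆ < e(Q)`. [folklore] -/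
theorem eStar_lt_energyPerParticle_of_truncated_surgery_periodic' (Q : PeriodicConfiguration 3)
    {δ : ℝ} (hδ : 0 < δ) (hsep : ∀ p ∈ Q.points, ∀ q ∈ Q.points, p ≠ q → δ ≤ dist p q)
    {n : ℕ} {xf : Fin n → E3} (hxf : Function.Injective xf) (hX : Set.range xf ⊆ Q.points)
    {k : ℕ} {R : Fin k → E3} (hR : Function.Injective R) (hdisj : Disjoint (Set.range R) (Q.points \ Set.range xf))
    {Rc : ℝ} (hRc : δ ≤ Rc) (tf : Fin n → Finset E3) (htf : ∀ i, ∀ y : E3, y ∈ tf i ↔ y ∈ Q.points \ Set.range xf ∧ dist (xf i) y ≤ Rc)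
    (tR : Fin k → Finset E3) (htR : ∀ i, ∀ y : E3, y ∈ tR i ↔ y ∈ Q.points \ Set.range xf ∧ dist (R i) y ≤ Rc)
    (hΔ : (interactionEnergy lennardJones R + ∑ i, ∑ y ∈ tR i, lennardJones (dist (R i) y)) -
        (interactionEnergy lennardJones xf + ∑ i, ∑ y ∈ tf i, lennardJones (dist (xf i) y)) +
        ((n : ℝ) + k) * ((δ⁻¹ ^ 6 / 12 + 1 / 6) * (1024 / (δ ^ 3 * Rc ^ 3))) < Q.energyPerParticle lennardJones * ((k : ℝ) - n)) :
    (⨅ Q' : PeriodicConfiguration 3, Q'.energyPerParticle lennardJones) < Q.energyPerParticle lennardJones := by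
  by_contra hle
  rw [not_lt] at hle
  have hG := isMuGSC_points_of_energyPerParticle_le Q hδ hsep hle
  have heq : Q.energyPerParticle lennardJones = ⨅ Q' : PeriodicConfiguration 3, Q'.energyPerParticle lennardJones :=
    le_antisymm hle (eStar_le Q)
  rw [← heq] at hG
  exact not_isMuGSC_of_truncated_surgery hδ hsep hxf hX hR hdisj hRc tf htf tR htR hΔ hG

end Summit.AtomisticToContinuum.Crystallization.Theorems.FrustratedLawDichotomyPeriodicTruncatedTest

end
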